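import Literature.MathematicalPhysics.KineticTheory.ConfinedBackward
import Literature.MathematicalPhysics.KineticTheory.ReyBelletThomas2002ForwardEquation
import HarnessLib

/-!
# Additive-noise SDEs with a confined drift: the Kolmogorov backward equation in distributional form

Trunk T-KINETIC (Literature/MathematicalPhysics/KineticTheory); theorems only, no named facts.
Continuation of `ConfinedBackward.lean`. For the transition kernels `P_t = sdeKernel Y v₁ v₂ t` of
a confined drift `Y` of constant divergence `d` with regular confined reversal `Y' = -Y`, an
additive Haar measure `μ`, and a SMOOTH FAMILY of pair observables `Θ ∈ C_c^∞(ℝ × E × E)`: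

* `ConfinedDrift.hasDerivAt_pairAct_family` — along the diagonal,
  `d/dt pairAct Θ(t,·) t = pairAct (∂_tΘ(t,·) + L̂₁Θ(t,·) - d Θ(t,·)) t` (`t > 0`): the time
  dependence of the observable contributes `∂_tΘ` (uniform Taylor bound in time), the motion of
  the kernels contributes `Lᵀ₁Θ = L̂₁Θ - dΘ` (the backward Dynkin identity `hasDerivAt_pairAct`);
* `ConfinedDrift.continuous_pairAct_family` — `t ↦ pairAct K(t,·) t` is continuous for a
  continuous compactly supported family `K`;
* `ConfinedDrift.backwardEquation` — **the backward equation in distributional form**: for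
  `Θ` supported in `(0, ∞) × E × E`,
  `∫₀^∞ pairAct (∂_tΘ(t,·) + L̂₁Θ(t,·) - d Θ(t,·)) t dt = 0`,
  i.e. the measure `m(dt, dx, dy) = dt μ(dx) P_t(x, dy)` on `(0,∞) × E × E` solves
  `⟨m, ∂_tΘ + Lᵀ_xΘ⟩ = 0` — the Kolmogorov BACKWARD equation `∂_t p = L_x p` for the transition
  densities, in the variables `(t, x)`, tested against `Θ`. Together with the forward equation in
  `(t, y)` (`MarkovSemigroupForwardEquation.lean`) this is the input of Hörmander's theorem on
  `ℝ × E × E` for the JOINT smoothness of `p_t(x, y)`.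

## References

* D. W. Stroock, S. R. S. Varadhan, *Multidimensional Diffusion Processes* (1979), §3.1.
* L. Rey-Bellet, L. E. Thomas, Comm. Math. Phys. 225 (2002) 305–329, §4 (the `C^∞` law from
  Hörmander's theorem). [folklore]
-/

noncomputable section

open MeasureTheory ProbabilityTheory Filter Topology Set Function Asymptotics
open scoped NNReal ENNReal ContDiff

namespace Literature.MathematicalPhysics.KineticTheory

open Literature.Probability.Process Literature.Analysis.ODE
open Literature.MathematicalPhysics.KineticTheory.HeatConduction

variable {E : Type*} [NormedAddCommGroup E] [NormedSpace ℝ E]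

/-! ### Smooth families of pair observables -/

section Family

variable {Y' : E → E} {v₁ v₂ : E} {Θ : ℝ × (E × E) → ℝ}

omit [NormedSpace ℝ E] in
/-- A compact `K₁` off which (in the `x`-variable) the whole family, its time derivative and
every function supported in `tsupport Θ` vanish. [folklore] -/
theorem exists_compact_fst_family (hΘc : HasCompactSupport Θ) :
    ∃ K₁ : Set E, IsCompact K₁ ∧ ∀ (t : ℝ) (x : E), x ∉ K₁ → ∀ y, (t, (x, y)) ∉ tsupport Θ :=
  ⟨(fun q : ℝ × (E × E) => q.2.1) '' tsupport Θ,
    hΘc.image (continuous_fst.comp continuous_snd),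
    fun t x hx y hmem => hx ⟨(t, (x, y)), hmem, rfl⟩⟩

/-- **`L̂₁` of a slice through the derivatives of the family**: for `Θ ∈ C²(ℝ × E × E)`,
`L̂₁[Θ(t,·)](x,y) = DΘ(t,x,y)·(0,(Y'x,0)) + ½ ∑_b D[q ↦ DΘ(q)·(0,(v_b,0))](t,x,y)·(0,(v_b,0))`.
[folklore] -/
theorem sdeGeneratorFst_family_eq (hΘ : ContDiff ℝ 2 Θ) (t : ℝ) (p : E × E) :
    sdeGeneratorFst Y' v₁ v₂ (fun p' => Θ (t, p')) p =
      fderiv ℝ Θ (t, p) (0, (Y' p.1, 0)) +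
        (1 / 2) * (fderiv ℝ (fun q : ℝ × (E × E) => fderiv ℝ Θ q (0, (v₁, 0))) (t, p) (0, (v₁, 0)) +
          fderiv ℝ (fun q : ℝ × (E × E) => fderiv ℝ Θ q (0, (v₂, 0))) (t, p) (0, (v₂, 0))) := by
  have hΘd : Differentiable ℝ Θ := hΘ.differentiable (by norm_num)
  have hslice : ContDiff ℝ 2 (fun p' : E × E => Θ (t, p')) := hΘ.comp (contDiff_const.prodMk contDiff_id)
  rw [sdeGeneratorFst_eq hslice]
  have h1 : ∀ w : E × E, (fun q : E × E => fderiv ℝ (fun p' => Θ (t, p')) q w) =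
      fun q => (fun r : ℝ × (E × E) => fderiv ℝ Θ r (0, w)) (t, q) :=
    fun w => funext fun q => fderiv_spaceSlice_apply hΘd t q w
  have hG : ∀ w : E × E, Differentiable ℝ (fun r : ℝ × (E × E) => fderiv ℝ Θ r (0, w)) := fun w =>
    ((hΘ.fderiv_right (m := 1) (by norm_num)).clm_apply contDiff_const).differentiable one_ne_zero
  rw [fderiv_spaceSlice_apply hΘd, h1 (v₁, 0), h1 (v₂, 0), fderiv_spaceSlice_apply (hG _),
    fderiv_spaceSlice_apply (hG _)]

/-- The family `(t, p) ↦ L̂₁[Θ(t,·)](p)` is continuous (`Y'` continuous, `Θ ∈ C²`). [folklore] -/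
theorem continuous_sdeGeneratorFst_family (hY' : Continuous Y') (hΘ : ContDiff ℝ 2 Θ) :
    Continuous fun q : ℝ × (E × E) => sdeGeneratorFst Y' v₁ v₂ (fun p' => Θ (q.1, p')) q.2 := by
  have heq : (fun q : ℝ × (E × E) => sdeGeneratorFst Y' v₁ v₂ (fun p' => Θ (q.1, p')) q.2) = fun q =>
      fderiv ℝ Θ q (0, (Y' q.2.1, 0)) +
        (1 / 2) * (fderiv ℝ (fun q' : ℝ × (E × E) => fderiv ℝ Θ q' (0, (v₁, 0))) q (0, (v₁, 0)) +
          fderiv ℝ (fun q' : ℝ × (E × E) => fderiv ℝ Θ q' (0, (v₂, 0))) q (0, (v₂, 0))) := by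
    funext q
    exact sdeGeneratorFst_family_eq hΘ q.1 q.2
  rw [heq]
  have h1 : Continuous (fderiv ℝ Θ) := hΘ.continuous_fderiv (by norm_num)
  have h2 : ∀ w : E × E, Continuous (fderiv ℝ (fun q' : ℝ × (E × E) => fderiv ℝ Θ q' (0, w))) := fun w =>
    ((hΘ.fderiv_right (m := 1) (by norm_num)).clm_apply contDiff_const).continuous_fderiv one_ne_zero
  exact (h1.clm_apply (continuous_const.prodMk
    (((hY'.comp (continuous_fst.comp continuous_snd)).prodMk continuous_const)))).add
    (continuous_const.mul (((h2 _).clm_apply continuous_const).add ((h2 _).clm_apply continuous_const)))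

/-- The family `(t, p) ↦ L̂₁[Θ(t,·)](p)` vanishes off `tsupport Θ`. [folklore] -/
theorem sdeGeneratorFst_family_eq_zero {q : ℝ × (E × E)} (hq : q ∉ tsupport Θ) :
    sdeGeneratorFst Y' v₁ v₂ (fun p' => Θ (q.1, p')) q.2 = 0 := by
  refine sdeGeneratorFst_eq_zero_of_notMem fun hmem => hq ?_
  have hsub : tsupport (fun p' : E × E => Θ (q.1, p')) ⊆ (fun p' => (q.1, p')) ⁻¹' tsupport Θ := by
    refine closure_minimal (fun p' hp' => subset_tsupport _ hp') ?_
    exact (isClosed_tsupport Θ).preimage (Continuous.prodMk_right q.1)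
  have h := hsub hmem
  simpa using h

/-- The family `(t, p) ↦ L̂₁[Θ(t,·)](p)` has compact support if `Θ` has. [folklore] -/
theorem hasCompactSupport_sdeGeneratorFst_family (hΘc : HasCompactSupport Θ) :
    HasCompactSupport fun q : ℝ × (E × E) => sdeGeneratorFst Y' v₁ v₂ (fun p' => Θ (q.1, p')) q.2 :=
  hΘc.mono' fun _ hq => by_contra fun h => hq (sdeGeneratorFst_family_eq_zero h)

end Family

/-! ### A calculus lemma -/

/-- If `c` is continuous at `t` and `|r(s)| ≤ C (s - t)²`, then `s ↦ (s - t) c(s) + r(s)` has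
derivative `c(t)` at `t`. [folklore] -/
theorem hasDerivAt_sub_mul_add {c r : ℝ → ℝ} {t : ℝ} (hc : ContinuousAt c t) {C : ℝ}
    (hr : ∀ s, |r s| ≤ C * (s - t) ^ 2) :
    HasDerivAt (fun s => (s - t) * c s + r s) (c t) t := by
  have hr0 : r t = 0 := by
    have h := hr t
    rw [sub_self, zero_pow two_ne_zero, mul_zero] at h
    exact abs_nonpos_iff.1 h
  rw [hasDerivAt_iff_isLittleO]
  simp only [sub_self, zero_mul, hr0, add_zero, sub_zero, smul_eq_mul]
  rw [isLittleO_iff]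
  intro ε hε
  have h1 : ∀ᶠ s in 𝓝 t, |c s - c t| ≤ ε / 2 := by
    have := Metric.tendsto_nhds.1 hc (ε / 2) (by positivity)
    filter_upwards [this] with s hs
    rw [Real.dist_eq] at hs
    exact hs.le
  have h2 : ∀ᶠ s in 𝓝 t, |C| * |s - t| ≤ ε / 2 := by
    have hct : ContinuousAt (fun s : ℝ => |C| * |s - t|) t :=
      (continuous_const.mul ((continuous_id.sub continuous_const).abs)).continuousAt
    have h0 : |C| * |t - t| < ε / 2 := by rw [sub_self, abs_zero, mul_zero]; positivity
    exact (hct.eventually (gt_mem_nhds h0)).mono fun s hs => hs.le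
  filter_upwards [h1, h2] with s hs1 hs2
  rw [Real.norm_eq_abs, Real.norm_eq_abs]
  have e : (s - t) * c s + r s - (s - t) * c t = (s - t) * (c s - c t) + r s := by ring
  rw [e]
  calc |(s - t) * (c s - c t) + r s| ≤ |(s - t) * (c s - c t)| + |r s| := abs_add_le _ _
    _ ≤ |s - t| * (ε / 2) + |C| * |s - t| * |s - t| := by
        rw [abs_mul]
        refine add_le_add (mul_le_mul_of_nonneg_left hs1 (abs_nonneg _)) ?_
        calc |r s| ≤ C * (s - t) ^ 2 := hr s
          _ ≤ |C| * (s - t) ^ 2 := mul_le_mul_of_nonneg_right (le_abs_self C) (sq_nonneg _)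
          _ = |C| * |s - t| * |s - t| := by rw [mul_assoc, abs_mul_abs_self, sq]
    _ ≤ |s - t| * (ε / 2) + ε / 2 * |s - t| := by
        refine add_le_add le_rfl (mul_le_mul_of_nonneg_right hs2 (abs_nonneg _))
    _ = ε * |s - t| := by ring

namespace ConfinedDrift

variable [FiniteDimensional ℝ E] [CompleteSpace E] [MeasurableSpace E] [BorelSpace E]
  [SecondCountableTopology E] {Y : E → E} (D : ConfinedDrift Y) {v₁ v₂ : E}
  (hv₁ : v₁ ∈ D.noise) (hv₂ : v₂ ∈ D.noise) (μ : Measure E) [μ.IsAddHaarMeasure]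
  {Y' : E → E} (D' : RegularConfinedDrift Y') (hv₁' : v₁ ∈ D'.noise) (hv₂' : v₂ ∈ D'.noise)
include D hv₁ hv₂

/-! ### Continuity along the diagonal -/

/-- **`t ↦ pairAct K(t,·) t⁺` is continuous** for a continuous compactly supported family `K` on
`ℝ × E × E` (uniform continuity of `K` in time, the bound `|pairAct| ≤ C μ(K₁)`, and continuity of
`s ↦ pairAct K(t,·) s⁺`). [folklore] -/
theorem continuous_pairAct_family {K : ℝ × (E × E) → ℝ} (hK : Continuous K) (hKc : HasCompactSupport K) :
    Continuous fun t : ℝ => pairAct Y v₁ v₂ μ (fun p => K (t, p)) t.toNNReal := by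
  obtain ⟨K₁, hK₁, hKK₁⟩ := exists_compact_fst_family hKc
  have hslc : ∀ t, Continuous fun p : E × E => K (t, p) := fun t => hK.comp (Continuous.prodMk_right t)
  have hsls : ∀ t, HasCompactSupport fun p : E × E => K (t, p) := fun t => hasCompactSupport_spaceSlice hKc t
  have huc := hKc.uniformContinuous_of_continuous hK
  refine continuous_iff_continuousAt.2 fun t => ?_
  rw [Metric.continuousAt_iff]
  intro ε hε
  -- continuity in the kernel time at the fixed slice `K(t, ·)`
  have hc1 : ContinuousAt (fun s : ℝ => pairAct Y v₁ v₂ μ (fun p => K (t, p)) s.toNNReal) t :=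
    (D.continuous_pairAct hv₁ hv₂ μ (hslc t) (hsls t)).continuousAt
  obtain ⟨δ₁, hδ₁, h1⟩ := Metric.continuousAt_iff.1 hc1 (ε / 2) (by positivity)
  -- uniform continuity of the family in time
  set η : ℝ := ε / (2 * (μ.real K₁ + 1)) with hη
  have hη0 : 0 < η := by rw [hη]; positivity
  obtain ⟨δ₂, hδ₂, h2⟩ := Metric.uniformContinuous_iff.1 huc η hη0
  refine ⟨min δ₁ δ₂, lt_min hδ₁ hδ₂, fun s hs => ?_⟩
  have hs1 : dist s t < δ₁ := hs.trans_le (min_le_left _ _)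
  have hs2 : dist s t < δ₂ := hs.trans_le (min_le_right _ _)
  -- `|pairAct (K_s - K_t) s⁺| ≤ η μ(K₁)`
  have hdiff : |pairAct Y v₁ v₂ μ (fun p => K (s, p) - K (t, p)) s.toNNReal| ≤ η * μ.real K₁ := by
    refine D.abs_pairAct_le hv₁ hv₂ μ ((hslc s).sub (hslc t)) hK₁ (fun x hx y => ?_) (fun p => ?_) _
    · show K (s, (x, y)) - K (t, (x, y)) = 0
      rw [image_eq_zero_of_notMem_tsupport (hKK₁ s x hx y), image_eq_zero_of_notMem_tsupport (hKK₁ t x hx y),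
        sub_zero]
    · have h := h2 (a := (s, p)) (b := (t, p)) (by
        rw [Prod.dist_eq, dist_self, max_eq_left dist_nonneg]; exact hs2)
      rw [Real.dist_eq] at h
      exact h.le
  rw [D.pairAct_sub hv₁ hv₂ μ (hslc s) (hsls s) (hslc t) (hsls t)] at hdiff
  have h1' := h1 hs1
  rw [Real.dist_eq] at h1' ⊢
  have hημ : η * μ.real K₁ < ε / 2 := by
    rw [hη, div_mul_eq_mul_div, div_lt_div_iff₀ (by positivity) (by positivity)]
    nlinarith [measureReal_nonneg (μ := μ) (s := K₁), hε]
  calc |pairAct Y v₁ v₂ μ (fun p => K (s, p)) s.toNNReal - pairAct Y v₁ v₂ μ (fun p => K (t, p)) t.toNNReal|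
      ≤ |pairAct Y v₁ v₂ μ (fun p => K (s, p)) s.toNNReal - pairAct Y v₁ v₂ μ (fun p => K (t, p)) s.toNNReal| +
        |pairAct Y v₁ v₂ μ (fun p => K (t, p)) s.toNNReal - pairAct Y v₁ v₂ μ (fun p => K (t, p)) t.toNNReal| :=
        abs_sub_le _ _ _
    _ < ε / 2 + ε / 2 := add_lt_add_of_le_of_lt (hdiff.trans hημ.le) h1'
    _ = ε := by ring

include D' hv₁' hv₂'

/-! ### The derivative along the diagonal -/

/-- **The derivative of `t ↦ pairAct Θ(t,·) t` along the diagonal**: for `Θ ∈ C_c^∞(ℝ × E × E)`,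
`Y' = -Y` a regular confined drift, `tr DY ≡ d`, and `t > 0`,
`d/dt pairAct Θ(t,·) t = pairAct (∂_tΘ(t,·)) t + (-d · pairAct Θ(t,·) t + pairAct (L̂₁Θ(t,·)) t)`.
[folklore] -/
theorem hasDerivAt_pairAct_family (hY' : ∀ y, Y' y = -Y y) {d : ℝ}
    (hdiv : ∀ y, LinearMap.trace ℝ E (fderiv ℝ Y y : E →ₗ[ℝ] E) = d) {Θ : ℝ × (E × E) → ℝ}
    (hΘ : ContDiff ℝ ∞ Θ) (hΘc : HasCompactSupport Θ) {t : ℝ} (ht : 0 < t) :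
    HasDerivAt (fun s : ℝ => pairAct Y v₁ v₂ μ (fun p => Θ (s, p)) s.toNNReal)
      (pairAct Y v₁ v₂ μ (fun p => fderiv ℝ Θ (t, p) (1, 0)) t.toNNReal +
        (-d * pairAct Y v₁ v₂ μ (fun p => Θ (t, p)) t.toNNReal +
          pairAct Y v₁ v₂ μ (sdeGeneratorFst Y' v₁ v₂ (fun p => Θ (t, p))) t.toNNReal)) t := by
  -- data
  obtain ⟨K₁, hK₁, hKK₁⟩ := exists_compact_fst_family hΘc
  set dΘ : ℝ × (E × E) → ℝ := fun q => fderiv ℝ Θ q (1, 0) with hdΘ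
  have hdΘs : ContDiff ℝ ∞ dΘ := contDiff_timeDeriv hΘ
  have hdΘc : HasCompactSupport dΘ := hasCompactSupport_timeDeriv hΘc
  obtain ⟨M₂, -, hM₂⟩ := exists_bound_of_hasCompactSupport' (contDiff_timeDeriv hdΘs).continuous
    (hasCompactSupport_timeDeriv hdΘc)
  have hslc : ∀ s, Continuous fun p : E × E => Θ (s, p) := fun s => (contDiff_spaceSlice hΘ s).continuous
  have hsls : ∀ s, HasCompactSupport fun p : E × E => Θ (s, p) := fun s => hasCompactSupport_spaceSlice hΘc s
  have hdslc : ∀ s, Continuous fun p : E × E => dΘ (s, p) := fun s => (contDiff_spaceSlice hdΘs s).continuous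
  have hdsls : ∀ s, HasCompactSupport fun p : E × E => dΘ (s, p) := fun s => hasCompactSupport_spaceSlice hdΘc s
  -- the remainder family `R_s = Θ_s - Θ_t - (s - t) ∂_tΘ_t`
  set R : ℝ → E × E → ℝ := fun s p => Θ (s, p) - Θ (t, p) - (s - t) * dΘ (t, p) with hR
  have hRc : ∀ s, Continuous (R s) := fun s =>
    ((hslc s).sub (hslc t)).sub (continuous_const.mul (hdslc t))
  have hRs : ∀ s, HasCompactSupport (R s) := fun s =>
    ((hsls s).sub (hsls t)).sub ((hdsls t).mul_left)
  have hRK₁ : ∀ s x, x ∉ K₁ → ∀ y, R s (x, y) = 0 := by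
    intro s x hx y
    simp only [hR]
    have h0 : ∀ s', Θ (s', (x, y)) = 0 := fun s' => image_eq_zero_of_notMem_tsupport (hKK₁ s' x hx y)
    have h1 : dΘ (t, (x, y)) = 0 := by
      rw [hdΘ]
      simp only
      rw [Function.notMem_support.1 fun hmem => hKK₁ t x hx y (support_fderiv_subset ℝ hmem)]
      rfl
    rw [h0, h0, h1]
    ring
  have hRb : ∀ s p, |R s p| ≤ M₂ * (s - t) ^ 2 := fun s p => abs_sub_sub_mul_timeDeriv_le hΘ hM₂ s t p
  -- `φ(s) = pairAct (Θ_s - Θ_t) s⁺ = (s - t) pairAct (∂_tΘ_t) s⁺ + pairAct R_s s⁺`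
  set c : ℝ → ℝ := fun s => pairAct Y v₁ v₂ μ (fun p => dΘ (t, p)) s.toNNReal with hc
  set r : ℝ → ℝ := fun s => pairAct Y v₁ v₂ μ (R s) s.toNNReal with hr
  have hcc : ContinuousAt c t := (D.continuous_pairAct hv₁ hv₂ μ (hdslc t) (hdsls t)).continuousAt
  have hrb : ∀ s, |r s| ≤ M₂ * μ.real K₁ * (s - t) ^ 2 := fun s => by
    have h := D.abs_pairAct_le hv₁ hv₂ μ (hRc s) hK₁ (hRK₁ s) (hRb s) s.toNNReal
    calc |r s| ≤ M₂ * (s - t) ^ 2 * μ.real K₁ := h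
      _ = M₂ * μ.real K₁ * (s - t) ^ 2 := by ring
  have hφ : HasDerivAt (fun s => (s - t) * c s + r s) (c t) t := hasDerivAt_sub_mul_add hcc hrb
  have hφeq : ∀ s, (s - t) * c s + r s =
      pairAct Y v₁ v₂ μ (fun p => Θ (s, p)) s.toNNReal - pairAct Y v₁ v₂ μ (fun p => Θ (t, p)) s.toNNReal := by
    intro s
    have hk1 : Continuous fun p : E × E => (s - t) * dΘ (t, p) := continuous_const.mul (hdslc t)
    have hk1s : HasCompactSupport fun p : E × E => (s - t) * dΘ (t, p) := (hdsls t).mul_left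
    simp only [hc, hr]
    rw [← D.pairAct_const_mul hv₁ hv₂ μ (hdslc t) (hdsls t) (s - t),
      ← D.pairAct_add hv₁ hv₂ μ hk1 hk1s (hRc s) (hRs s),
      ← D.pairAct_sub hv₁ hv₂ μ (hslc s) (hsls s) (hslc t) (hsls t)]
    congr 1
    funext p
    simp only [hR]
    ring
  -- the motion of the kernels at the fixed slice `Θ_t`
  have h2 := D.hasDerivAt_pairAct hv₁ hv₂ μ D' hv₁' hv₂' hY' hdiv ((contDiff_spaceSlice hΘ t).of_le
    (WithTop.coe_le_coe.2 le_top)) (hsls t) ht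
  -- assemble
  have hsum := hφ.add h2
  have hfun : ((fun s => (s - t) * c s + r s) + fun s => pairAct Y v₁ v₂ μ (fun p => Θ (t, p)) s.toNNReal) =
      fun s => pairAct Y v₁ v₂ μ (fun p => Θ (s, p)) s.toNNReal := by
    funext s
    simp only [Pi.add_apply]
    rw [hφeq s]
    ring
  rw [hfun] at hsum
  exact hsum

/-! ### The backward equation -/

/-- **The Kolmogorov backward equation in distributional form.** For `Y' = -Y` a regular confined
drift, `tr DY ≡ d`, and every test function `Θ ∈ C_c^∞(ℝ × E × E)` supported in `(0, ∞) × E × E`: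
`∫₀^∞ pairAct (∂_tΘ(t,·) + L̂₁Θ(t,·) - d Θ(t,·)) t dt = 0`, i.e. the measure
`dt μ(dx) P_t(x, dy)` solves `⟨m, (∂_t + Lᵀ_x)Θ⟩ = 0`. [folklore] -/
theorem backwardEquation (hY' : ∀ y, Y' y = -Y y) {d : ℝ}
    (hdiv : ∀ y, LinearMap.trace ℝ E (fderiv ℝ Y y : E →ₗ[ℝ] E) = d) {Θ : ℝ × (E × E) → ℝ}
    (hΘ : ContDiff ℝ ∞ Θ) (hΘc : HasCompactSupport Θ) (hΘ0 : tsupport Θ ⊆ Set.Ioi (0 : ℝ) ×ˢ Set.univ) :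
    ∫ t in Set.Ioi (0 : ℝ),
      pairAct Y v₁ v₂ μ (fun p => fderiv ℝ Θ (t, p) (1, 0) +
        (sdeGeneratorFst Y' v₁ v₂ (fun p' => Θ (t, p')) p - d * Θ (t, p))) t.toNNReal = 0 := by
  have hY'c : Continuous Y' := D'.contDiff_drift.continuous
  -- the family `G = ∂_tΘ + L̂₁Θ - dΘ`, continuous with compact support
  set Gf : ℝ × (E × E) → ℝ := fun q => fderiv ℝ Θ q (1, 0) +
    (sdeGeneratorFst Y' v₁ v₂ (fun p' => Θ (q.1, p')) q.2 - d * Θ q) with hGf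
  have hGfc : Continuous Gf :=
    (contDiff_timeDeriv hΘ).continuous.add
      ((continuous_sdeGeneratorFst_family hY'c (hΘ.of_le (WithTop.coe_le_coe.2 le_top))).sub
        (continuous_const.mul hΘ.continuous))
  have hGfs : HasCompactSupport Gf :=
    (hasCompactSupport_timeDeriv hΘc).add
      ((hasCompactSupport_sdeGeneratorFst_family hΘc).sub hΘc.mul_left)
  set F : ℝ → ℝ := fun s => pairAct Y v₁ v₂ μ (fun p => Θ (s, p)) s.toNNReal with hF
  set G : ℝ → ℝ := fun s => pairAct Y v₁ v₂ μ (fun p => Gf (s, p)) s.toNNReal with hG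
  -- the slices
  have hslc : ∀ s, Continuous fun p : E × E => Θ (s, p) := fun s => (contDiff_spaceSlice hΘ s).continuous
  have hsls : ∀ s, HasCompactSupport fun p : E × E => Θ (s, p) := fun s => hasCompactSupport_spaceSlice hΘc s
  have hdslc : ∀ s, Continuous fun p : E × E => fderiv ℝ Θ (s, p) (1, 0) := fun s =>
    (contDiff_spaceSlice (contDiff_timeDeriv hΘ) s).continuous
  have hdsls : ∀ s, HasCompactSupport fun p : E × E => fderiv ℝ Θ (s, p) (1, 0) := fun s =>
    hasCompactSupport_spaceSlice (hasCompactSupport_timeDeriv hΘc) s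
  have hLslc : ∀ s, Continuous (sdeGeneratorFst Y' v₁ v₂ (fun p' => Θ (s, p'))) := fun s =>
    continuous_sdeGeneratorFst hY'c ((contDiff_spaceSlice hΘ s).of_le (WithTop.coe_le_coe.2 le_top))
  have hLsls : ∀ s, HasCompactSupport (sdeGeneratorFst Y' v₁ v₂ (fun p' => Θ (s, p'))) := fun s =>
    hasCompactSupport_sdeGeneratorFst (hsls s)
  -- `F' = G` on `(0, ∞)`
  have hderiv : ∀ t : ℝ, 0 < t → HasDerivAt F (G t) t := by
    intro t ht
    have h := D.hasDerivAt_pairAct_family hv₁ hv₂ μ D' hv₁' hv₂' hY' hdiv hΘ hΘc ht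
    refine h.congr_deriv ?_
    have hA : Continuous fun p : E × E =>
        sdeGeneratorFst Y' v₁ v₂ (fun p' => Θ (t, p')) p - d * Θ (t, p) :=
      (hLslc t).sub (continuous_const.mul (hslc t))
    have hAs : HasCompactSupport fun p : E × E =>
        sdeGeneratorFst Y' v₁ v₂ (fun p' => Θ (t, p')) p - d * Θ (t, p) :=
      (hLsls t).sub (hsls t).mul_left
    have hB : Continuous fun p : E × E => d * Θ (t, p) := continuous_const.mul (hslc t)
    have hBs : HasCompactSupport fun p : E × E => d * Θ (t, p) := (hsls t).mul_left
    simp only [hG, hGf]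
    rw [D.pairAct_add hv₁ hv₂ μ (hdslc t) (hdsls t) hA hAs, D.pairAct_sub hv₁ hv₂ μ (hLslc t) (hLsls t) hB hBs,
      D.pairAct_const_mul hv₁ hv₂ μ (hslc t) (hsls t)]
    ring
  -- the time support of `Θ` lies in `[δ, T₁]` with `δ > 0`
  have hKc : IsCompact (tsupport Θ) := hΘc
  obtain ⟨δ, hδ0, hδ⟩ : ∃ δ : ℝ, 0 < δ ∧ ∀ p ∈ tsupport Θ, δ < p.1 := by
    rcases (tsupport Θ).eq_empty_or_nonempty with he | hne
    · exact ⟨1, one_pos, fun p hp => by simp [he] at hp⟩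
    · obtain ⟨p₀, hp₀, hmin⟩ := hKc.exists_isMinOn hne continuous_fst.continuousOn
      have h0 : 0 < p₀.1 := (hΘ0 hp₀).1
      exact ⟨p₀.1 / 2, by positivity, fun p hp => by have := hmin hp; simp at this; linarith⟩
  obtain ⟨T, hT⟩ := (hKc.image continuous_fst).bddAbove
  have hT' : ∀ p ∈ tsupport Θ, p.1 ≤ T := fun p hp => hT ⟨p, hp, rfl⟩
  set T₁ : ℝ := max T δ + 1 with hT₁
  have hδT : δ ≤ T₁ := by rw [hT₁]; linarith [le_max_right T δ]
  have hout : ∀ t : ℝ, (t ≤ δ ∨ T₁ ≤ t) → ∀ p, (t, p) ∉ tsupport Θ := by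
    intro t ht p hmem
    rcases ht with ht | ht
    · exact absurd (hδ _ hmem) (not_lt.2 ht)
    · have := hT' _ hmem
      simp only at this
      rw [hT₁] at ht
      linarith [le_max_left T δ]
  have hΘout : ∀ t : ℝ, (t ≤ δ ∨ T₁ ≤ t) → (fun p : E × E => Θ (t, p)) = fun _ => 0 := fun t ht =>
    funext fun p => image_eq_zero_of_notMem_tsupport (hout t ht p)
  have hGfout : ∀ t : ℝ, (t ≤ δ ∨ T₁ ≤ t) → (fun p : E × E => Gf (t, p)) = fun _ => 0 := by
    intro t ht
    funext p
    simp only [hGf]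
    have h1 : fderiv ℝ Θ (t, p) (1, 0) = 0 := by
      rw [Function.notMem_support.1 fun hmem => hout t ht p (support_fderiv_subset ℝ hmem)]; rfl
    have h2 : sdeGeneratorFst Y' v₁ v₂ (fun p' => Θ (t, p')) p = 0 :=
      sdeGeneratorFst_family_eq_zero (q := (t, p)) (hout t ht p)
    rw [h1, h2, image_eq_zero_of_notMem_tsupport (hout t ht p)]
    ring
  have hPA0 : ∀ s : ℝ≥0, pairAct Y v₁ v₂ μ (fun _ : E × E => (0 : ℝ)) s = 0 := fun s => by
    simp [pairAct_def]
  have hGout : ∀ t : ℝ, (t ≤ δ ∨ T₁ ≤ t) → G t = 0 := fun t ht => by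
    simp only [hG]
    rw [hGfout t ht, hPA0]
  have hFout : ∀ t : ℝ, (t ≤ δ ∨ T₁ ≤ t) → F t = 0 := fun t ht => by
    simp only [hF]
    rw [hΘout t ht, hPA0]
  -- FTC on `[δ, T₁]`
  have hderiv' : ∀ t ∈ uIcc δ T₁, HasDerivAt F (G t) t := fun t ht => by
    rw [uIcc_of_le hδT] at ht
    exact hderiv t (hδ0.trans_le ht.1)
  have hGcont : Continuous G := D.continuous_pairAct_family hv₁ hv₂ μ hGfc hGfs
  have hint : IntervalIntegrable G volume δ T₁ := hGcont.intervalIntegrable _ _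
  have hFTC := intervalIntegral.integral_eq_sub_of_hasDerivAt hderiv' hint
  rw [hFout δ (Or.inl le_rfl), hFout T₁ (Or.inr le_rfl), sub_zero] at hFTC
  have hsub : Ioc δ T₁ ⊆ Ioi (0 : ℝ) := fun t ht => hδ0.trans ht.1
  rw [setIntegral_eq_of_subset_of_forall_sdiff_eq_zero measurableSet_Ioi hsub fun t ht => ?_,
    ← intervalIntegral.integral_of_le hδT]
  · exact hFTC
  · have ht2 : ¬ (δ < t ∧ t ≤ T₁) := ht.2
    rw [not_and_or, not_lt, not_le] at ht2
    rcases ht2 with h | h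
    · exact hGout t (Or.inl h)
    · exact hGout t (Or.inr h.le)

end ConfinedDrift

end Literature.MathematicalPhysics.KineticTheory
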